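import Literature.IUT.HodgeArakelov.ThetaEvaluationSubgraphs
import Literature.IUT.HodgeArakelov.MonoThetaProjective

/-!
# [IUTchII] Definition 2.7 (i): NON-VACUITY of the input record `MonoThetaProjData` — unconditionally,
# and at the cell's own mono-theta environments / projective systems (Def. 1.1 (i), Prop. 1.5)

Mochizuki, *Inter-universal Teichmüller theory II*, §2, Definition 2.7 (i), kurims manuscript (Dec. 2020)
pp. 80–81 [claim: Mochizuki2012, status: disputed] (IUTchII §2 Def 2.7 (i), kurims p.81): "`Π_{M^Θ_*}` …
a natural homomorphism of topological groups `Π_{M^Θ_*} → Π_X(M^Θ_*)` whose kernel may be identified with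
the exterior cyclotome `Π_μ(M^Θ_*)`, and whose image is the subgroup … determined by `Π^tp_{Y_v}`",
together with `Π_{v¨▶} ⊆ Π_{v▶} ⊆ Π_v` (Def. 2.3 (ii)).  Record-only vocabulary under the claim key
`Mochizuki2012` (D-0012, disputed); abc-iut cell, layer L6, NON-VACUITY CERTIFICATE (L6-lead §F v1.18p
«NV-L6 WAVE», interface `MonoThetaProjData` of abc-iut-L6-t2's `ThetaEvaluationSubgraphs.lean`, which the
INHABITATION CENSUS v3 of abc-iut-w5-d114 lists with zero producers; DAG nodes `IUTchII:Def2.7(i)/(ii)` of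
`Summits/ABC/IUTFork/DAGL6d.lean` quantify over it).  PROOF-ONLY: no `def`, no `instance`, no named fact.

What the kernel says:

* `MonoThetaProjData.nonempty` — the record is inhabited over ALL carriers `P`, `Q` (DEGENERATE witness:
  the trivial homomorphism, `Π_{v▶} = Π_{v¨▶} = ⊤`, image `⊥`).  Reason, stated honestly: the record is INPUT
  DATA — its only law `range_eq` NAMES the image of `proj`; nothing ties the fields to mono-theta
  environments.  `MonoThetaProjData.exists_of_hom` is the exact inhabitation description: EVERY homomorphism
  `f : P →* Q` with a nested pair of subgroups `Π_{v¨▶} ≤ Π_{v▶}` of `Q` is such a datum (image `:= f.range`).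
* `MonoThetaProjData.exists_model_level` — the MODEL datum at a mono-theta environment `M` with its
  Def. 1.1 (i) output `R : Reconstruction M` (abc-iut-L6-t1, `MonoThetaCyclotomes.lean`; producers in the tree:
  `EtaleLevels.modelRecon`, `ModelFrame.reconstruction`, `Reconstruction.transport`): `proj := Π_M ↠ Π_Y(M) ⊆ Π_X(M)`,
  and then, AS PRINTED, the Def. 2.7 (i) exterior cyclotome `Ker(proj)` IS `Π_μ(M) = Ker(Π_M ↠ Π_Y(M))`
  (Def. 1.1 (i); `inclY` is injective) and the image IS `Π_Y(M) ⊆ Π_X(M)` (`projY` is surjective).  The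
  subgroups `Π_{v▶}`, `Π_{v¨▶}` of Def. 2.3 (ii) are SUPPLIED (their producer, the subgraph `Γ^▶_X` data of
  Props. 2.1–2.4, is not in the tree: `SubgraphReference` has no producer) — honest limit.
* `MonoThetaProjData.exists_model_system` — the same over a PROJECTIVE SYSTEM `Sys : MonoThetaProjSystem F`
  of Prop. 1.5 (producers: `EtaleLevels.modelSystem`, `EtaleLevels.naturalSystem`), with `Π_{M^Θ_*}` REALISED
  as the group of compatible families `{x ∈ ∏_M Π_{M^Θ_M} | trans (x M') = x M}` (written as an infimum of
  equaliser subgroups, so that no definition is introduced) and `proj` the member-`1` projection to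
  `Π_X(M^Θ_*) := Π_X(M^Θ_1)` (the tree's identification, `MonoThetaProjSystem.PiX`): the Prop. 1.5 (iii)
  limit exterior cyclotome `Π_μ(M^Θ_*) = MonoThetaProjSystem.extCycLim` lies in the kernel, with EQUALITY
  when the transition maps `Π_X(M^Θ_{M}) → Π_X(M^Θ_1)` are injective (the first clause of Prop. 1.5 (ii),
  `transitionsAreIsos`, supplies bijectivity) — "whose kernel may be identified with the exterior cyclotome
  `Π_μ(M^Θ_*)`".

HONEST LABEL: genuine-shaped over the cell's interfaces `Reconstruction` / `MonoThetaProjSystem` (themselves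
inhabited only over [EtTh]-side data, cell MERGE-MAP), degenerate in closed form.  Nothing here bears on
[IUTchIII] Cor. 3.12; no side is taken; typed ≠ proved elsewhere.
-/

namespace Literature.IUT.HodgeArakelov

universe u v

namespace MonoThetaProjData

/-- **Non-vacuity, unconditional (DEGENERATE witness)** (IUTchII Def. 2.7 (i), kurims p. 81): over any groups
`P`, `Q` the input record is inhabited — trivial `proj`, `Π_{v▶} = Π_{v¨▶} = ⊤`, image `⊥`.  The record carries
no law beyond `range_eq`, which names the image. [claim: Mochizuki2012, status: disputed]
(IUTchII §2 Def 2.7 (i), kurims p.81) -/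
theorem nonempty (P : Type u) (Q : Type v) [Group P] [Group Q] : Nonempty (MonoThetaProjData P Q) :=
  ⟨⟨1, ⊤, ⊤, le_rfl, (1 : P →* Q).range, rfl⟩⟩

/-- **Exact inhabitation description** (IUTchII Def. 2.7 (i), kurims p. 81): every homomorphism `f : P →* Q`
("`Π_{M^Θ_*} → Π_X(M^Θ_*)`") together with a nested pair `Π_{v¨▶} ≤ Π_{v▶}` of subgroups of `Q` (Def. 2.3 (ii))
IS a `MonoThetaProjData P Q`, with image entry `f.range`. [claim: Mochizuki2012, status: disputed]
(IUTchII §2 Def 2.7 (i), kurims p.81) -/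
theorem exists_of_hom {P : Type u} {Q : Type v} [Group P] [Group Q] (f : P →* Q) (D DD : Subgroup Q)
    (h : DD ≤ D) :
    ∃ X : MonoThetaProjData P Q, X.proj = f ∧ X.PivD = D ∧ X.PivDD = DD ∧ X.PiY = f.range :=
  ⟨⟨f, D, DD, h, f.range, rfl⟩, rfl, rfl, rfl, rfl⟩

/-- **The MODEL datum at a mono-theta environment** (IUTchII Def. 2.7 (i) p. 81 with Def. 1.1 (i) pp. 20–21):
for `M` with Def. 1.1 (i) output `R` — `Π_M ↠ Π_Y(M) ⊆ Π_X(M)` — and supplied `Π_{v¨▶} ≤ Π_{v▶} ⊆ Π_X(M)`,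
the datum with `proj := inclY ∘ projY` exists, its Def. 2.7 (i) exterior cyclotome `Ker(proj)` IS
`Π_μ(M) = Ker(Π_M ↠ Π_Y(M))` ("whose kernel may be identified with the exterior cyclotome") and its image IS
`Π_Y(M)` ("whose image is the subgroup … determined by `Π^tp_{Y_v}`").  PROVED (`inclY` injective, `projY`
surjective). [claim: Mochizuki2012, status: disputed] (IUTchII §2 Def 2.7 (i), kurims p.81) -/
theorem exists_model_level {S : ThetaSetting.{u}} {M : MonoThetaEnv S} (R : Reconstruction M)
    (D DD : Subgroup R.PiX) (h : DD ≤ D) :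
    ∃ X : MonoThetaProjData M.Pi R.PiX,
      X.proj = R.inclY.comp R.projY ∧ X.PivD = D ∧ X.PivDD = DD ∧
        X.exteriorCyclotome = R.extCyc ∧ X.PiY = R.inclY.range := by
  refine ⟨⟨R.inclY.comp R.projY, D, DD, h, (R.inclY.comp R.projY).range, rfl⟩, rfl, rfl, rfl, ?_, ?_⟩
  · -- `Ker(inclY ∘ projY) = Ker(projY)` since `inclY` is injective
    ext x
    simp only [exteriorCyclotome, MonoidHom.mem_ker, MonoidHom.coe_comp, Function.comp_apply]
    constructor
    · intro hx
      exact R.inclY_isOpenEmbedding.injective (by simpa using hx)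
    · intro hx
      rw [hx, map_one]
  · -- `range (inclY ∘ projY) = range inclY` since `projY` is surjective
    show (R.inclY.comp R.projY).range = R.inclY.range
    rw [MonoidHom.range_comp, MonoidHom.range_eq_top.mpr R.projY_surjective, ← MonoidHom.range_eq_map]

/-- **The MODEL datum over a projective system of mono-theta environments** (IUTchII Def. 2.7 (i) p. 81
over Prop. 1.5, kurims p. 29): for `Sys : MonoThetaProjSystem F`, realise `Π_{M^Θ_*}` as the group of
compatible families `{x ∈ ∏_M Π_{M^Θ_M} | trans (x M') = x M for M ∣ M'}` and `proj` as the member-`1`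
projection `x ↦ (Π_{M^Θ_1} ↠ Π_Y(M^Θ_1) ⊆ Π_X(M^Θ_1) = Π_X(M^Θ_*))`.  Then the datum (with supplied
`Π_{v¨▶} ≤ Π_{v▶}`) exists, and the Prop. 1.5 (iii) limit exterior cyclotome `Π_μ(M^Θ_*)`
(`MonoThetaProjSystem.extCycLim`, the compatible families of `Π_μ(M^Θ_M)`'s) LIES IN its Def. 2.7 (i)
exterior cyclotome `Ker(proj)` — unconditionally — with EQUALITY as soon as the maps
`Π_X(M^Θ_M) → Π_X(M^Θ_*)` are injective (supplied by the first clause of Prop. 1.5 (ii),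
`MonoThetaProjSystem.transitionsAreIsos`): "whose kernel may be identified with the exterior cyclotome
`Π_μ(M^Θ_*)`".  PROVED. [claim: Mochizuki2012, status: disputed] (IUTchII §2 Def 2.7 (i), kurims p.81) -/
theorem exists_model_system {S : ThetaSetting.{u}} {F : ModelFamily S} (Sys : MonoThetaProjSystem F)
    (D DD : Subgroup Sys.PiX) (h : DD ≤ D) :
    ∃ X : MonoThetaProjData
        (⨅ (M : ℕ+) (M' : ℕ+) (hd : (M : ℕ) ∣ (M' : ℕ)),
          MonoidHom.eqLocus ((Sys.trans hd).comp (Pi.evalMonoidHom (fun N : ℕ+ => (Sys.env N).Pi) M'))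
            (Pi.evalMonoidHom (fun N : ℕ+ => (Sys.env N).Pi) M) : Subgroup (∀ N : ℕ+, (Sys.env N).Pi))
        Sys.PiX,
      X.proj = ((Sys.recon 1).inclY.comp (Sys.recon 1).projY).comp
          ((Pi.evalMonoidHom (fun N : ℕ+ => (Sys.env N).Pi) 1).comp (Subgroup.subtype _)) ∧
      X.PivD = D ∧ X.PivDD = DD ∧ X.PiY = X.proj.range ∧
      Sys.extCycLim ≤ X.exteriorCyclotome.map (Subgroup.subtype _) ∧
      ((∀ M : ℕ+, Function.Injective (Sys.toPiX M)) →
        X.exteriorCyclotome.map (Subgroup.subtype _) = Sys.extCycLim) := by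
  refine ⟨⟨((Sys.recon 1).inclY.comp (Sys.recon 1).projY).comp
      ((Pi.evalMonoidHom (fun N : ℕ+ => (Sys.env N).Pi) 1).comp (Subgroup.subtype _)),
    D, DD, h, _, rfl⟩, rfl, rfl, rfl, rfl, ?_, ?_⟩
  · -- `Π_μ(M^Θ_*) ⊆ Ker(proj)`: a compatible family of elements of `Ker(Π_M ↠ Π_Y(M))` is a compatible
    -- family whose member at `1` dies in `Π_Y(M^Θ_1)`, hence in `Π_X(M^Θ_1)`.
    rintro x ⟨hx, hx'⟩
    refine ⟨⟨x, ?_⟩, ?_, rfl⟩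
    · simp only [Subgroup.mem_iInf]
      intro M M' hd
      exact hx' M M' hd
    · have h1 : (Sys.recon 1).projY (x 1) = 1 := hx 1
      show (Sys.recon 1).inclY ((Sys.recon 1).projY (x 1)) = 1
      rw [h1, map_one]
  · -- under injectivity of `Π_X(M^Θ_M) → Π_X(M^Θ_*)`: equality
    intro hinj
    apply le_antisymm
    · rintro _ ⟨y, hy, rfl⟩
      have hy1 : (Sys.recon 1).inclY ((Sys.recon 1).projY ((y : ∀ N : ℕ+, (Sys.env N).Pi) 1)) = 1 := by
        simpa [exteriorCyclotome, MonoidHom.mem_ker] using hy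
      have hcompat : ∀ (M M' : ℕ+) (hd : (M : ℕ) ∣ (M' : ℕ)),
          Sys.trans hd ((y : ∀ N : ℕ+, (Sys.env N).Pi) M') = (y : ∀ N : ℕ+, (Sys.env N).Pi) M := by
        intro M M' hd
        have := y.2
        simp only [Subgroup.mem_iInf] at this
        exact this M M' hd
      refine ⟨fun M => ?_, hcompat⟩
      -- transport the vanishing at `1` to level `M` through `transX`, then cancel `inclY`
      have key : Sys.toPiX M ((Sys.recon M).inclY ((Sys.recon M).projY
          ((y : ∀ N : ℕ+, (Sys.env N).Pi) M))) = Sys.toPiX M 1 := by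
        rw [map_one, MonoThetaProjSystem.toPiX, Sys.transX_compat, hcompat 1 M (one_dvd _), hy1]
      have h2 := hinj M key
      rw [← map_one (Sys.recon M).inclY] at h2
      exact (Sys.recon M).inclY_isOpenEmbedding.injective h2
    · rintro x ⟨hx, hx'⟩
      refine ⟨⟨x, ?_⟩, ?_, rfl⟩
      · simp only [Subgroup.mem_iInf]
        intro M M' hd
        exact hx' M M' hd
      · have h1 : (Sys.recon 1).projY (x 1) = 1 := hx 1
        show (Sys.recon 1).inclY ((Sys.recon 1).projY (x 1)) = 1
        rw [h1, map_one]

end MonoThetaProjData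

end Literature.IUT.HodgeArakelov
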